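import Summits.QuantumFields.BalabanUV.T4Continuum.Support.NE7K1LinSchurFoldBox

/-!
# NE7K1LinTorusLineASplit — row NE7 (node U5), candidate route HOM, path H1L, cell K1-lin(s): NEEDS-ESTIMATE #E1, R-E1 TRANCHE E
# (operator-level torus docking), STEP 2a — THE `a`-SPLIT OF THE TWO-CUTOFF LINE: `torLine(n, a, s) = torLine(n, 0, s) + (a∕n^{d+1})·1[same n-block]`
# for EVERY `s` — run A's averaging term `aQ_n^*Q_n` and the one hidden in run B's hard Schur complement (`aQ_{nL}^*Q_{nL}` seen through the
# `L`-block chart) are THE SAME coarse operator, so the line is «translation-invariant part + a·(block projector)» exactly as B4 (2.44) needs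

Lineage `b2b-balaban-t4-ne7-p2` (CRUX PROVER NE7 #2), generation 76; file 73.  File 72 typed the Sherman–Morrison step `(M + a·Q*Q)Φ_p = Q*χ_p`
for any fine operator `M` with the fibre waves as eigenvectors; to apply it to the line one needs the line's operator at `a > 0` in the form
`M + a·Q_n^*Q_n` with `M = torLine(n, 0, s)` (the translation-invariant object of files 36–41 whose plane waves are eigenvectors).  THIS FILE
proves that form ([folklore] block-matrix algebra over file 30's chart calculus and file 32's block-sum matrices):

* §1 ABSTRACT: for a chart `T` with read-out `S·T·u = ℓ·u_inl` (file 30's `hST` shape) and ANY coarse matrix `K`,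
  **`chartOp_sandwich`**: `chartOp c T (Sᵀ·K·S) = fromBlocks ((c·ℓ²)·K) 0 0 0` — a fine operator that factors through the block sums moves
  only the coarse-coarse block of the chart operator; `schurC_add_inl`: `schurC (H + fromBlocks X 0 0 0) = schurC H + X`;
  `lineOpR_add`: adding the same `Y` to `P₀` and to `A₁₁` adds `Y` to the line, for every `s`.
* §2 CONCRETE: `blockInd n R` (`= 1[same n-block]`), `torOpK_eq_add` (`torOpK n a = torOpK n 0 + (a∕n^{d+1})·blockInd n`), the nesting
  `blk n ∘ blk L = blk (nL)` (inlined; the tree's `B4Thm110ZeroBox.blk_blk`) ⇒ **`blockInd_mul_eq_sandwich`**: `blockInd (nL) T = (bsum L T)ᵀ·blockInd n (T.image (blk L))·bsum L T`;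
  **`torB_eq_add`**: `torB hTL n a N = torB hTL n 0 N + fromBlocks ((a∕n^{d+1})·blockInd n _) 0 0 0` (the chart constant `L^{−(d+1)}`, the
  read-out `L^{d+1}` twice and `(nL)^{−(d+1)}` combine to `n^{−(d+1)}`); hence **`torLine_eq_add`**:
  `torLine hTL n a Nf Nc s = torLine hTL n 0 Nf Nc s + (a∕n^{d+1})·blockInd n (T.image (blk L))` for EVERY real `s`, every `a`.

NEXT (step 2b∕3, successor or this lineage): instantiate file 72's `soft_resolvent` with `M := torLine(n,0,s)` on the fine doubled torus
(`L := n`-blocks), identify `(torLine(n,a,s))⁻¹·(block indicator)ᵀ·χ_p = resField` by `isUnit_det_torLine`, and Fourier-invert to file 68's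
`torusKernelS`.

HONEST FRAMING: [folklore] algebra; an identity between the lineage's own typed matrices; nothing of Bałaban's asserted; no `sorry`.  Census
only; NE7 NOT PRINTED ∕ NOT PROVED; spine 0∕9; FIXED FINITE T⁴, rung (B)+1; NOT infinite volume, NOT mass gap, NOT Clay.  HONEST DEPENDENCY:
continuum YM on T⁴ ⇐ BetaPertH ∧ nine spine estimates (0/9 proved); BetaPertH ⇐ (D1) ∧ (D4) ∧ CAP+tail; G-an2-4 gates asym, D1 and NE2/3/4.
-/

noncomputable section

open Finset Matrix

namespace Summit.QuantumFields.BalabanUV.T4Continuum.NE7K1LinTorusLineASplit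

open Literature.MathematicalPhysics.QuantumFieldTheory.Balaban1983to89
open Literature.MathematicalPhysics.QuantumFieldTheory.Balaban1983to89.B4Reflection242
open Literature.MathematicalPhysics.QuantumFieldTheory.Balaban1983to89.B4Lower18
open NE7K1LinSchurLineForm NE7K1LinSchurFold NE7K1LinFoldMatrices NE7K1LinTorusChart NE7K1LinSchurFoldBox NE7K1LinBlockCoords

variable {d : ℕ}

/-! ### §1 Abstract: a fine operator factoring through the block sums moves only the coarse block of the chart operator -/

section Abstract

variable {ι κc κf : Type*} [Fintype ι]

/-- the entries of `S·T` under the read-out identity: `(S·T) b (inl b′) = ℓ·[b′ = b]`. [folklore] -/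
theorem bsum_mul_chart_inl [Fintype κc] [Fintype κf] [DecidableEq κc] [DecidableEq κf] {ℓ : ℝ} {T : Matrix ι (κc ⊕ κf) ℝ}
    {S : Matrix κc ι ℝ} (hST : ∀ u : κc ⊕ κf → ℝ, S *ᵥ (T *ᵥ u) = fun b => ℓ * u (Sum.inl b)) (b b' : κc) :
    (S * T) b (Sum.inl b') = if b' = b then ℓ else 0 := by
  rw [bsum_mul_chart_apply hST b (Sum.inl b')]
  simp only [Pi.single_apply, Sum.inl.injEq]
  split_ifs with h1 h2 h2
  · ring
  · exact absurd h1.symm h2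
  · exact absurd h2.symm h1
  · ring

/-- the fluctuation columns of `S·T` vanish. [folklore] -/
theorem bsum_mul_chart_inr [Fintype κc] [Fintype κf] [DecidableEq κc] [DecidableEq κf] {ℓ : ℝ} {T : Matrix ι (κc ⊕ κf) ℝ}
    {S : Matrix κc ι ℝ} (hST : ∀ u : κc ⊕ κf → ℝ, S *ᵥ (T *ᵥ u) = fun b => ℓ * u (Sum.inl b)) (b : κc) (f : κf) :
    (S * T) b (Sum.inr f) = 0 := by
  rw [bsum_mul_chart_apply hST b (Sum.inr f)]
  simp

/-- entries of a sandwich `Aᵀ·K·A`. [folklore] -/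
theorem sandwich_apply [Fintype κc] {κ : Type*} (A : Matrix κc κ ℝ) (K : Matrix κc κc ℝ) (j j' : κ) :
    (Aᵀ * K * A) j j' = ∑ b', (∑ b, A b j * K b b') * A b' j' := by
  simp only [Matrix.mul_apply, Matrix.transpose_apply]

/-- **THE SANDWICH LEMMA**: under the read-out identity `S·T·u = ℓ·u_inl`, for ANY coarse matrix `K`,
`chartOp c T (Sᵀ·K·S) = fromBlocks ((c·ℓ²)·K) 0 0 0` — only the coarse-coarse block of the chart operator moves. [folklore] -/
theorem chartOp_sandwich [Fintype κc] [Fintype κf] [DecidableEq κc] [DecidableEq κf] {c ℓ : ℝ} {T : Matrix ι (κc ⊕ κf) ℝ}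
    {S : Matrix κc ι ℝ} (hST : ∀ u : κc ⊕ κf → ℝ, S *ᵥ (T *ᵥ u) = fun b => ℓ * u (Sum.inl b)) (K : Matrix κc κc ℝ) :
    chartOp c T (Sᵀ * K * S) = Matrix.fromBlocks ((c * ℓ ^ 2) • K) 0 0 0 := by
  set A : Matrix κc (κc ⊕ κf) ℝ := S * T with hA
  have hinl : ∀ b b' : κc, A b (Sum.inl b') = if b' = b then ℓ else 0 := fun b b' => by
    rw [hA]; exact bsum_mul_chart_inl hST b b'
  have hinr : ∀ (b : κc) (f : κf), A b (Sum.inr f) = 0 := fun b f => by rw [hA]; exact bsum_mul_chart_inr hST b f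
  have hprod : Tᵀ * (Sᵀ * K * S) * T = Aᵀ * K * A := by
    rw [hA, Matrix.transpose_mul]
    simp only [Matrix.mul_assoc]
  unfold chartOp
  rw [hprod]
  ext j j'
  rw [Matrix.smul_apply, sandwich_apply, smul_eq_mul]
  rcases j with b | f <;> rcases j' with b' | f'
  · simp_rw [hinl]
    simp only [Matrix.fromBlocks_apply₁₁, Matrix.smul_apply, smul_eq_mul, ite_mul, zero_mul, Finset.sum_ite_eq,
      Finset.mem_univ, if_true, mul_ite, mul_zero]
    ring
  · simp_rw [hinr, mul_zero, Finset.sum_const_zero, mul_zero]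
    simp
  · simp_rw [hinr, zero_mul, Finset.sum_const_zero, zero_mul, Finset.sum_const_zero, mul_zero]
    simp
  · simp_rw [hinr, mul_zero, Finset.sum_const_zero, mul_zero]
    simp

/-- `chartOp` is additive in the fine operator. [folklore] -/
theorem chartOp_add (c : ℝ) (T : Matrix ι (κc ⊕ κf) ℝ) (M M' : Matrix ι ι ℝ) :
    chartOp c T (M + M') = chartOp c T M + chartOp c T M' := by
  unfold chartOp
  rw [Matrix.mul_add, Matrix.add_mul, smul_add]

/-- `chartOp` is homogeneous in the fine operator. [folklore] -/
theorem chartOp_smul (c r : ℝ) (T : Matrix ι (κc ⊕ κf) ℝ) (M : Matrix ι ι ℝ) :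
    chartOp c T (r • M) = r • chartOp c T M := by
  unfold chartOp
  rw [Matrix.mul_smul, Matrix.smul_mul, smul_comm]

/-- adding a coarse-coarse block moves the Schur complement by that block. [folklore] -/
theorem schurC_add_inl [Fintype κf] [DecidableEq κf] (H : Matrix (κc ⊕ κf) (κc ⊕ κf) ℝ) (X : Matrix κc κc ℝ) :
    schurC (H + Matrix.fromBlocks X 0 0 0) = schurC H + X := by
  unfold schurC
  have h11 : (H + Matrix.fromBlocks X 0 0 0).toBlocks₁₁ = H.toBlocks₁₁ + X := by
    ext i j; simp [Matrix.toBlocks₁₁]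
  have h12 : (H + Matrix.fromBlocks X 0 0 0).toBlocks₁₂ = H.toBlocks₁₂ := by
    ext i j; simp [Matrix.toBlocks₁₂]
  have h21 : (H + Matrix.fromBlocks X 0 0 0).toBlocks₂₁ = H.toBlocks₂₁ := by
    ext i j; simp [Matrix.toBlocks₂₁]
  have h22 : (H + Matrix.fromBlocks X 0 0 0).toBlocks₂₂ = H.toBlocks₂₂ := by
    ext i j; simp [Matrix.toBlocks₂₂]
  rw [h11, h12, h21, h22]
  abel

/-- the blocks of `H + fromBlocks X 0 0 0`. [folklore] -/
theorem toBlocks_add_inl (H : Matrix (κc ⊕ κf) (κc ⊕ κf) ℝ) (X : Matrix κc κc ℝ) :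
    (H + Matrix.fromBlocks X 0 0 0).toBlocks₁₁ = H.toBlocks₁₁ + X ∧ (H + Matrix.fromBlocks X 0 0 0).toBlocks₁₂ = H.toBlocks₁₂ ∧
      (H + Matrix.fromBlocks X 0 0 0).toBlocks₂₁ = H.toBlocks₂₁ ∧ (H + Matrix.fromBlocks X 0 0 0).toBlocks₂₂ = H.toBlocks₂₂ := by
  refine ⟨?_, ?_, ?_, ?_⟩
  · ext i j; simp [Matrix.toBlocks₁₁]
  · ext i j; simp [Matrix.toBlocks₁₂]
  · ext i j; simp [Matrix.toBlocks₂₁]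
  · ext i j; simp [Matrix.toBlocks₂₂]

/-- adding the same `Y` to both endpoints of the line adds `Y` to the line, every `s`. [folklore] -/
theorem lineOpR_add [Fintype κf] [DecidableEq κf] (P₀ A₁ Y : Matrix κc κc ℝ) (B : Matrix κc κf ℝ) (C : Matrix κf κc ℝ) (D : Matrix κf κf ℝ) (s : ℝ) :
    lineOpR (P₀ + Y) (A₁ + Y) B C D s = lineOpR P₀ A₁ B C D s + Y := by
  unfold lineOpR
  ext i j
  simp only [Matrix.add_apply, Matrix.smul_apply, Matrix.sub_apply, smul_eq_mul]
  ring

end Abstract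

/-! ### §2 Concrete: the block indicator, the nesting of blocks, and the `a`-split of `torOpK`, `torB`, `torLine` -/

/-- the SAME-`n`-BLOCK INDICATOR matrix `1[blk n x = blk n y]` on a region (B4's `n^{d+1}·Q_n^*Q_n`). [folklore] -/
def blockInd (n : ℕ) (R : Finset (Fin (d + 1) → ℤ)) : Matrix ↥R ↥R ℝ :=
  Matrix.of fun x y => if blk n y.1 = blk n x.1 then 1 else 0

/-- unfolding lemma. [folklore] -/
@[simp] theorem blockInd_apply (n : ℕ) (R : Finset (Fin (d + 1) → ℤ)) (x y : ↥R) :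
    blockInd n R x y = if blk n y.1 = blk n x.1 then 1 else 0 := rfl

/-- the block indicator is `SᵀS` (file 32's `bsum_transpose_mul_bsum_apply`). [folklore] -/
theorem blockInd_eq_bsum (n : ℕ) (R : Finset (Fin (d + 1) → ℤ)) : blockInd n R = (bsum n R)ᵀ * bsum n R := by
  ext x y
  rw [blockInd_apply, bsum_transpose_mul_bsum_apply]

/-- **THE `a`-SPLIT OF THE PERIODIC FINE OPERATOR**: `torOpK n a N F = torOpK n 0 N F + (a∕n^{d+1})·blockInd n F`. [folklore] -/
theorem torOpK_eq_add (n : ℕ) (a : ℝ) (N : Fin (d + 1) → ℕ) (F : Finset (Fin (d + 1) → ℤ)) :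
    torOpK n a N F = torOpK n 0 N F + (a * ((n : ℝ) ^ (d + 1))⁻¹) • blockInd n F := by
  ext x y
  simp only [torOpK_apply, Matrix.add_apply, Matrix.smul_apply, blockInd_apply, smul_eq_mul, zero_mul]
  split_ifs <;> ring

/-- **THE `nL`-BLOCK INDICATOR FACTORS THROUGH THE `L`-BLOCK SUMS**: `blockInd (nL) T = (bsum L T)ᵀ·blockInd n (T.image (blk L))·bsum L T`.
[folklore] -/
theorem blockInd_mul_eq_sandwich (n L : ℕ) (T : Finset (Fin (d + 1) → ℤ)) :
    blockInd (n * L) T = (bsum L T)ᵀ * blockInd n (T.image (blk L)) * bsum L T := by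
  classical
  ext x y
  rw [Matrix.mul_apply]
  simp_rw [Matrix.mul_apply, Matrix.transpose_apply, bsum_apply, blockInd_apply]
  -- the inner sum collapses at `β = rblk L T x`, the outer at `β′ = rblk L T y`
  have inner : ∀ β' : ↥(T.image (blk L)),
      (∑ β : ↥(T.image (blk L)), (if rblk L T x = β then (1 : ℝ) else 0) * (if blk n β'.1 = blk n β.1 then 1 else 0)) =
        if blk n β'.1 = blk n (rblk L T x).1 then 1 else 0 := by
    intro β'
    rw [Finset.sum_eq_single (rblk L T x)]
    · simp
    · intro β _ hβ; simp [Ne.symm hβ]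
    · intro h; exact absurd (Finset.mem_univ _) h
  simp_rw [inner]
  rw [Finset.sum_eq_single (rblk L T y)]
  · simp only [if_true, mul_one]
    have e1 : (rblk L T x).1 = blk L x.1 := rfl
    have e2 : (rblk L T y).1 = blk L y.1 := rfl
    -- nesting of blocks `blk n (blk L z) = blk (nL) z` (the tree's `B4Thm110ZeroBox.blk_blk`, inlined to keep the import light)
    have nest : ∀ z : Fin (d + 1) → ℤ, blk n (blk L z) = blk (n * L) z := fun z => by
      funext μ
      simp only [blk]
      push_cast
      rw [Int.ediv_ediv_of_nonneg (Int.natCast_nonneg L), mul_comm]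
    rw [e1, e2, nest, nest]
  · intro β _ hβ; simp [Ne.symm hβ]
  · intro h; exact absurd (Finset.mem_univ _) h

section Torus

variable {n L : ℕ} [NeZero L] {T : Finset (Fin (d + 1) → ℤ)}

/-- **THE `a`-SPLIT OF RUN B'S CHART OPERATOR**: `torB hTL n a N = torB hTL n 0 N + fromBlocks ((a∕n^{d+1})·blockInd n (T.image (blk L))) 0 0 0`
— the averaging term of run B, seen in the `L`-block chart, is a pure coarse-coarse block equal to run A's averaging term
(`L^{−(d+1)}·(L^{d+1})²·(nL)^{−(d+1)} = n^{−(d+1)}`). [folklore] -/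
theorem torB_eq_add (hTL : IsBlockUnion L T) {n : ℕ} (hn : 1 ≤ n) (a : ℝ) (N : Fin (d + 1) → ℕ) :
    torB hTL n a N = torB hTL n 0 N +
      Matrix.fromBlocks ((a * ((n : ℝ) ^ (d + 1))⁻¹) • blockInd n (T.image (blk L))) 0 0 0 := by
  have hL0 : (L : ℝ) ≠ 0 := by exact_mod_cast NeZero.ne L
  have hn0 : (n : ℝ) ≠ 0 := by exact_mod_cast (show n ≠ 0 by omega)
  unfold torB
  rw [torOpK_eq_add (n * L) a N T, chartOp_add, chartOp_smul, blockInd_mul_eq_sandwich,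
    chartOp_sandwich (c := ((L : ℝ) ^ (d + 1))⁻¹) (bsum_coordT hTL)]
  congr 1
  rw [Matrix.fromBlocks_smul]
  simp only [smul_zero, smul_smul]
  congr 2
  push_cast
  rw [mul_pow]
  field_simp

/-- **THE `a`-SPLIT OF THE TWO-CUTOFF LINE ON THE TORUS**: for EVERY real `s` and every `a`,
`torLine hTL n a Nf Nc s = torLine hTL n 0 Nf Nc s + (a∕n^{d+1})·blockInd n (T.image (blk L))` — the line at `a` is its
translation-invariant part (`a = 0`, files 36–41) plus `a·Q_n^*Q_n`. [folklore] -/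
theorem torLine_eq_add (hTL : IsBlockUnion L T) {n : ℕ} (hn : 1 ≤ n) (a : ℝ) (Nf Nc : Fin (d + 1) → ℕ) (s : ℝ) :
    torLine hTL n a Nf Nc s = torLine hTL n 0 Nf Nc s + (a * ((n : ℝ) ^ (d + 1))⁻¹) • blockInd n (T.image (blk L)) := by
  unfold torLine
  obtain ⟨h11, h12, h21, h22⟩ := toBlocks_add_inl (torB hTL n 0 Nf)
    ((a * ((n : ℝ) ^ (d + 1))⁻¹) • blockInd n (T.image (blk L)))
  rw [torB_eq_add hTL hn a Nf, h11, h12, h21, h22, torOpK_eq_add n a Nc, lineOpR_add]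

/-- entrywise form of the split. [folklore] -/
theorem torLine_apply_eq_add (hTL : IsBlockUnion L T) {n : ℕ} (hn : 1 ≤ n) (a : ℝ) (Nf Nc : Fin (d + 1) → ℕ) (s : ℝ)
    (x y : ↥(T.image (blk L))) :
    torLine hTL n a Nf Nc s x y = torLine hTL n 0 Nf Nc s x y +
      (if blk n y.1 = blk n x.1 then a * ((n : ℝ) ^ (d + 1))⁻¹ else 0) := by
  rw [torLine_eq_add hTL hn]
  simp only [Matrix.add_apply, Matrix.smul_apply, blockInd_apply, smul_eq_mul, mul_ite, mul_one, mul_zero]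

end Torus

end Summit.QuantumFields.BalabanUV.T4Continuum.NE7K1LinTorusLineASplit

end
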